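import Summits.QuantumFields.BalabanUV.T4Continuum.Support.ShellMeasurePlaquetteCubicLocatedDichOut

/-!
# `T4Continuum.ShellMeasurePlaquetteCubicFrozenBlock` — REPAIR of F-ne7cleaf02g9-1, part 7 (row S77 f6, the consumer's
# side of the owner's SHAPE (1)): EXTENSION BY ZERO from the MOVING bonds to ALL letters is a norm-non-increasing linear
# map of the `WMax` spaces, so part 5's frozen-boundary END composes (f2a `Prop4Hyp.comp_of_norm_le`) to the pinned (P4)
# binder of the BLOCK FUNCTIONAL — defined on the block's own field space, exterior letters frozen at the background
(cell `pub-balaban`, sub-cell `t4`, spine estimate NE7c (node U5b); NE7c ROUND-2 crew, unit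
`b2b-balaban-t4-ne7c-formalise-leaf-02` gen 9; owner RULINGS R-ne7cp1-g32-3 (l.18202) ∕ R-ne7cp1-g33-4 (b) (l.19100);
ADDITIVE — imports part 5 `ShellMeasurePlaquetteCubicLocatedDichOut` ONLY; [folklore]; one data `def` (`extZ`, the
extension-by-zero CLM) + one `instance`, 0 `def … : Prop`, 0 sorry, 0 citation tags)

HONEST FRAMING.  Finite four-torus programme, rung (B)+1 only — NOT infinite volume, NOT a mass gap, NOT the Clay
problem, NOT summit progress; (B), `BetaPertHyp`, (B^μ) are not consumed.  NE7c (`T4IndicatorShell.ShellWeightBound`)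
is NOT PRINTED in [Balaban 1983–89] and NOT PROVED; «NE7c ⇐ the named binders» (trigger c3).  ELEMENTARY linear
bookkeeping for OUR typed action; nothing printed is asserted; no estimate of Bałaban's is discharged; which bonds are
moving, which letters are frozen and at what value is node O's ([dict]; a frozen letter `V(b)e^{X_b}` with `X_b ≠ 0` is
the background `U₀(b) := V(b)e^{X_b}` of part 5 — the extension by ZERO below is the chart's origin on the frozen letters).
HONEST DEPENDENCY (cell): continuum YM on T⁴ ⇐ BetaPertH ∧ nine spine estimates (0/9 proved); BetaPertH ⇐ (D1) ∧ (D4) ∧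
CAP+tail; G-an2-4 gates asym, D1 and NE2/3/4.

THE POINT.  Part 5's `prop4Hyp_pinned_ord₃_eta_levels_frozen_torusPin` reads the gradient at the moving bonds
`incl : ι → ↥Λ` of a functional of ALL letters `Λ`.  The block functional of END-II is a functional of the MOVING letters
only; it is part 5's functional COMPOSED with extension by zero.  THIS FILE:
* §1 `extZ incl : (ι → 𝔄) →L[ℂ] (Λ → 𝔄)` (extension by zero along an injective `incl`; `extZ_apply_incl`,
  `extZ_apply_of_forall_ne`), and **`norm_extZ_wmax_le`**: read from `WMax (w ∘ incl) wd (Dv ∘L extZ)` to `WMax w wd Dv`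
  it does NOT increase the norm (the ∇-datum of the block field IS the ∇-datum of its extension — cross-boundary
  covariant derivatives included, as the honest boundary demands);
* §2 **`Prop4Hyp.comp_extZ`**: any `Prop4Hyp W C a` on `WMax w wd Dv` gives `Prop4Hyp (W ∘ extZ) C a` on the block space;
* §3 **`prop4Hyp_pinned_ord₃_eta_levels_frozen_block`**: part 5's frozen-boundary END so composed — the pinned (P4) binder
  `hW` of END-II∕S70 f4∕S76∕S80 for OUR action as a functional ON THE BLOCK FIELD SPACE, full stars of the moving bonds,
  frozen exterior letters at the background, ORIGINAL stencil constant; NON-VACUOUS by part 6 (same geometric binders +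
  `incl` injective, which part 6's `incl` is).
Nothing in the countdown moves; NE7c NOT PROVED; spine PROVED 0∕9.
-/

noncomputable section

open scoped BigOperators

namespace Summit.QuantumFields.BalabanUV.T4Continuum.ShellMeasurePlaquetteCubicFrozenBlock

open Literature.MathematicalPhysics.QuantumFieldTheory.Balaban1983to89
open B7Prop1Explicit (e U1 mem_U1)
open B8Ineq132 (covDerivFwd)
open B11Prop6Scheme (Prop4Hyp)
open B12Decay510Torus (pl1)
open TreeLengthTorus (TPt proj)
open ShellMeasureWilsonGradientTail (plaqWord bonds)
open ShellMeasurePlaquetteTwist (plaqFunSym)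
open ShellMeasureLocalGradientTailJet (ord₃)
open Summit.QuantumFields.BalabanUV.T4Continuum.ShellMeasureCommutatorVariation (plaqStar)
open Summit.QuantumFields.BalabanUV.T4Continuum.ShellMeasureCommutatorGradientLocal (baseSites nbhdSites)
open Summit.QuantumFields.BalabanUV.T4Continuum.ShellMeasureCommutatorLocGrad (ext)
open Summit.QuantumFields.BalabanUV.T4Continuum.ShellMeasureLocalGradientTail (locGrad)
open Summit.QuantumFields.BalabanUV.T4Continuum.ShellMeasureMultiGridNorms (WSup Prop4Hyp.comp_of_norm_le)
open Summit.QuantumFields.BalabanUV.T4Continuum.ShellMeasureMultiGridNormsMax (WMax)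
open Summit.QuantumFields.BalabanUV.T4Continuum.ShellMeasurePinnedNorm (pinW pinDist)
open Summit.QuantumFields.BalabanUV.T4Continuum.ShellMeasureWilsonRemainderLevels (etaScale)
open Summit.QuantumFields.BalabanUV.T4Continuum.ShellMeasurePlaquetteCubicLocatedDichOut
  (prop4Hyp_pinned_ord₃_eta_levels_frozen_torusPin)

export B7Prop1Explicit (Site)

/-! ## §1 Extension by zero and its `WMax` norm -/

section Ext

variable {Λ : Type*} [Fintype Λ] [DecidableEq Λ] {𝔄 : Type*} [NormedAddCommGroup 𝔄] [NormedSpace ℂ 𝔄]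
  {Λ' : Type*} [Fintype Λ'] {𝔅 : Type*} [NormedAddCommGroup 𝔅] [NormedSpace ℂ 𝔅]
  {ι : Type*} [Fintype ι] (incl : ι → Λ)

/-- EXTENSION BY ZERO along `incl : ι → Λ` as a continuous linear map of flat field spaces:
`(extZ incl Y) b = Σ_{c : incl c = b} Y c` (for injective `incl`: `Y c` at `b = incl c`, `0` off the image). [folklore] -/
def extZ : (ι → 𝔄) →L[ℂ] (Λ → 𝔄) :=
  ContinuousLinearMap.pi fun b : Λ =>
    ∑ c ∈ Finset.univ.filter (fun c : ι => incl c = b), ContinuousLinearMap.proj (R := ℂ) (φ := fun _ : ι => 𝔄) c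

omit [Fintype Λ] [Fintype Λ'] in
/-- Unfolding. [folklore] -/
theorem extZ_apply (Y : ι → 𝔄) (b : Λ) :
    extZ incl Y b = ∑ c ∈ Finset.univ.filter (fun c : ι => incl c = b), Y c := by
  simp [extZ]

omit [Fintype Λ] [Fintype Λ'] in
/-- On the image of an injective `incl` the extension reads the block field. [folklore] -/
theorem extZ_apply_incl (hincl : Function.Injective incl) (Y : ι → 𝔄) (c : ι) : extZ incl Y (incl c) = Y c := by
  rw [extZ_apply]
  have hS : Finset.univ.filter (fun c' : ι => incl c' = incl c) = {c} := by
    ext c'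
    simp only [Finset.mem_filter, Finset.mem_univ, true_and, Finset.mem_singleton]
    exact ⟨fun h => hincl h, fun h => by rw [h]⟩
  rw [hS, Finset.sum_singleton]

omit [Fintype Λ] [Fintype Λ'] in
/-- Off the image the extension vanishes (the frozen letters sit at the chart's origin). [folklore] -/
theorem extZ_apply_of_forall_ne {b : Λ} (hb : ∀ c, incl c ≠ b) (Y : ι → 𝔄) : extZ incl Y b = 0 := by
  rw [extZ_apply]
  have hS : Finset.univ.filter (fun c : ι => incl c = b) = ∅ := by
    ext c
    simp [hb c]
  rw [hS, Finset.sum_empty]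

/-- pulled-back weights are positive. [folklore] -/
instance instFactCompIncl (w : Λ → ℝ) [hw : Fact (∀ b, 0 < w b)] : Fact (∀ c : ι, 0 < w (incl c)) :=
  ⟨fun c => hw.out (incl c)⟩

variable (w : Λ → ℝ) [hw : Fact (∀ b, 0 < w b)] (wd : Λ' → ℝ) [hwd : Fact (∀ i, 0 < wd i)]
  (Dv : (Λ → 𝔄) →L[ℂ] (Λ' → 𝔅))

/-- **EXTENSION BY ZERO DOES NOT INCREASE THE `WMax` NORM.**  Read from the block space
`WMax (w ∘ incl) wd (Dv ∘L extZ incl)` (weights pulled back; the ∇-datum of a block field := the ∇-datum of its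
extension by zero) to `WMax w wd Dv`, for injective `incl`: `‖extZ Y‖ ≤ ‖Y‖` — both halves of the max norm are read
off term by term. [folklore] -/
theorem norm_extZ_wmax_le (hincl : Function.Injective incl)
    (Y : WMax (fun c : ι => w (incl c)) wd (Dv.comp (extZ incl))) :
    ‖((WMax.toPiL w wd Dv).symm (extZ incl (WMax.toPiL (fun c : ι => w (incl c)) wd (Dv.comp (extZ incl)) Y)) :
        WMax w wd Dv)‖ ≤ ‖Y‖ := by
  set E : WMax w wd Dv :=
    (WMax.toPiL w wd Dv).symm (extZ incl (WMax.toPiL (fun c : ι => w (incl c)) wd (Dv.comp (extZ incl)) Y)) with hE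
  have hY0 : 0 ≤ ‖Y‖ := norm_nonneg _
  -- the underlying functions
  have hEb : ∀ b : Λ, (E : Λ → 𝔄) b = extZ incl (show ι → 𝔄 from Y) b := fun _ => rfl
  rw [WMax.norm_def]
  refine max_le ?_ ?_
  · -- the field half: weighted components on the image are the block's, off the image they vanish
    refine (WSup.norm_le_iff w 1 hY0).2 fun b => ?_
    by_cases hb : ∃ c, incl c = b
    · obtain ⟨c, rfl⟩ := hb
      have h1 : (show WSup w 1 𝔄 from E) (incl c) = Y c := by
        show (E : Λ → 𝔄) (incl c) = Y c
        rw [hEb, extZ_apply_incl incl hincl]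
      rw [h1]
      have h := WSup.norm_apply_le (fun c : ι => w (incl c)) 1
        (show WSup (fun c : ι => w (incl c)) 1 𝔄 from Y) c
      exact h.trans (WMax.norm_wsup_le _ wd (Dv.comp (extZ incl)) Y)
    · have h0 : (show WSup w 1 𝔄 from E) b = 0 := by
        show (E : Λ → 𝔄) b = 0
        rw [hEb]
        exact extZ_apply_of_forall_ne incl (fun c hc => hb ⟨c, hc⟩) _
      rw [h0, norm_zero, mul_zero]
      exact hY0
  · -- the ∇ half: `Dv (extZ Y)` IS the block's ∇-datum
    have h2 : (show WSup wd 2 𝔅 from Dv E) = (show WSup wd 2 𝔅 from (Dv.comp (extZ incl)) Y) := rfl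
    rw [h2]
    exact WMax.norm_deriv_le (fun c : ι => w (incl c)) wd (Dv.comp (extZ incl)) Y

/-! ## §2 `Prop4Hyp` passes to the block space -/

/-- **ANY (98)-SHAPE STATEMENT ON ALL LETTERS GIVES ONE ON THE BLOCK** (f2a `Prop4Hyp.comp_of_norm_le` with §1): for
injective `incl`, `Prop4Hyp W C a` on `WMax w wd Dv` ⟹ `Prop4Hyp (W ∘ extZ) C a` on `WMax (w ∘ incl) wd (Dv ∘L extZ)`,
`0 ≤ C`. [folklore] -/
theorem Prop4Hyp.comp_extZ (hincl : Function.Injective incl) {𝒵 : Type*} [NormedAddCommGroup 𝒵] [NormedSpace ℂ 𝒵]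
    {W : WMax w wd Dv → 𝒵} {C a : ℝ} (hW : Prop4Hyp W C a) (hC : 0 ≤ C) :
    Prop4Hyp (fun Y : WMax (fun c : ι => w (incl c)) wd (Dv.comp (extZ incl)) =>
      W ((WMax.toPiL w wd Dv).symm (extZ incl (WMax.toPiL (fun c : ι => w (incl c)) wd (Dv.comp (extZ incl)) Y))))
      C a := by
  -- the extension read between the `WMax` spaces, as a continuous linear map of norm ≤ 1
  set T : WMax (fun c : ι => w (incl c)) wd (Dv.comp (extZ incl)) →L[ℂ] WMax w wd Dv :=
    LinearMap.mkContinuous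
      (((WMax.toPiL w wd Dv).symm : (Λ → 𝔄) →L[ℂ] WMax w wd Dv).toLinearMap.comp
        (((extZ incl : (ι → 𝔄) →L[ℂ] (Λ → 𝔄)).toLinearMap).comp
          (WMax.toPiL (fun c : ι => w (incl c)) wd (Dv.comp (extZ incl)) :
            WMax (fun c : ι => w (incl c)) wd (Dv.comp (extZ incl)) →L[ℂ] (ι → 𝔄)).toLinearMap))
      1 (fun Y => by
        rw [one_mul]
        exact norm_extZ_wmax_le incl w wd Dv hincl Y) with hT
  have hTn : ∀ Y, ‖T Y‖ ≤ ‖Y‖ := fun Y => norm_extZ_wmax_le incl w wd Dv hincl Y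
  exact Prop4Hyp.comp_of_norm_le hW hC T hTn

end Ext

/-! ## §3 The pinned (P4) binder of the BLOCK functional -/

section Block

variable {d : ℕ} {𝔸 : Type*} [NormedRing 𝔸] [NormOneClass 𝔸] [NormedAlgebra ℂ 𝔸] [CompleteSpace 𝔸]
  (Λ : Finset (Site d × Fin d)) (Pl : Finset (Fin d × Fin d × Site d)) (τ : 𝔸 →L[ℂ] ℂ)
  {U₀ : Site d → Fin d → 𝔸ˣ} (h₀ : ∀ y κ, U₀ y κ ∈ U1 𝔸) (bd : Fin d × Fin d × Site d → (Fin 4 → ↥Λ × Bool))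
  (wt : ↥Λ → ℝ) [hwt : Fact (∀ b, 0 < wt b)] {I : Type*} [Fintype I] (wd : I → ℝ) [hwd : Fact (∀ i, 0 < wd i)]
  (Dv : (↥Λ → 𝔸) →L[ℂ] (I → 𝔸)) (Wf Wd : ↥Λ → ℝ) (W : Fin d × Fin d × Site d → ℝ)
  {ι : Type*} [Fintype ι] (incl : ι → ↥Λ)

include h₀ in
/-- **THE PINNED (P4) BINDER OF THE BLOCK FUNCTIONAL — FULL STARS OF THE MOVING BONDS, FROZEN EXTERIOR LETTERS AT THE
BACKGROUND, ORIGINAL CONSTANT.**  Part 5's `prop4Hyp_pinned_ord₃_eta_levels_frozen_torusPin` (letters `Λ`, moving bonds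
`incl : ι → ↥Λ` INJECTIVE, `Pl` ⊇ their full stars with boundaries in `Λ`, the usual weights∕floors∕∇-domination∕
regularity binders, torus pin) COMPOSED with extension by zero (§2): the functional
`Yb ↦ (c ↦ (wt (incl c))³·e^{δ′ϖ}·locGrad (etaScale η (Σ_{p∈Pl} ord₃ plaqFunSym_p)) (extZ Yb) (incl c))` ON THE BLOCK
FIELD SPACE `WMax ((wt·pin) ∘ incl) wd (Dv ∘L extZ)` satisfies
`Prop4Hyp (·) ((72(d−1)‖τ‖Lc³·((3d+2)d) + 8κLc⁴·16d)·e^{2δ′}) (ε∕2)` — the shape END-II consumes as `hW`, for OUR action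
at a live slot in the honest-boundary typing; nothing printed is asserted. [folklore] -/
theorem prop4Hyp_pinned_ord₃_eta_levels_frozen_block (hincl : Function.Injective incl) {η : ℝ} (hη : 0 < η)
    (htr : ∀ P Q : 𝔸, τ (P * Q) = τ (Q * P)) (hincr : ∀ p ∈ Pl, p.1 < p.2.1) {Lc : ℝ} (hLc : 1 ≤ Lc)
    (hst : ∀ c : ι, plaqStar (incl c).1.1 (incl c).1.2 ⊆ Pl)
    (hbd : ∀ p ∈ Pl, ((bd p 0).1 : Site d × Fin d) = (p.2.2, p.1) ∧ ((bd p 1).1 : Site d × Fin d) = (p.2.2 + e p.1, p.2.1)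
      ∧ ((bd p 2).1 : Site d × Fin d) = (p.2.2 + e p.2.1, p.1) ∧ ((bd p 3).1 : Site d × Fin d) = (p.2.2, p.2.1))
    (hor : ∀ p ∈ Pl, (bd p 0).2 = true ∧ (bd p 1).2 = true ∧ (bd p 2).2 = false ∧ (bd p 3).2 = false)
    (hWd0 : ∀ c : ι, 0 < Wd (incl c))
    (hWf : ∀ (c : ι) (b' : ↥Λ), b'.1.1 ∈ nbhdSites (incl c).1.1 (incl c).1.2 → Wf (incl c) ≤ wt b')
    (hcf : ∀ c : ι, wt (incl c) ≤ Lc * Wf (incl c)) (hcd : ∀ c : ι, wt (incl c) ≤ Lc * Wd (incl c))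
    (hDv : ∀ (A : ↥Λ → 𝔸) (c : ι) (x : Site d) (κ' τ' : Fin d), x ∈ baseSites (incl c).1.1 →
      Wd (incl c) ^ 2 * ‖covDerivFwd η U₀ κ' (fun z => ext Λ A z τ') x‖ ≤ ‖(WSup.toPiL wd 2).symm (Dv A)‖)
    {ε ε₀ : ℝ} (hε : 0 < ε) (hε₀ : 0 ≤ ε₀) (hε4 : 4 * ε ≤ 1) (hηW : ∀ p ∈ Pl, η ≤ W p)
    (hWw : ∀ p ∈ Pl, ∀ b ∈ bonds (bd p), W p ≤ wt b) (hwW : ∀ p ∈ Pl, ∀ b ∈ bonds (bd p), wt b ≤ Lc * W p)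
    (hreg : ∀ p ∈ Pl, ‖(plaqWord (fun b : ↥Λ => U₀ b.1.1 b.1.2) (bd p) (0 : ↥Λ → 𝔸) : 𝔸) - 1‖ ≤ ε₀ * (η / W p) ^ 2)
    (hd1 : 1 ≤ d) {T : ℕ} [NeZero T] (B₀ : Finset (TPt d T)) (hB₀ : B₀.Nonempty) {δ' : ℝ} (hδ' : 0 ≤ δ') :
    Prop4Hyp (fun Yb : WMax (fun c : ι => wt (incl c) * pinW δ' (pinDist B₀ hB₀ ∘ fun c : ι => proj T (incl c).1.1) c)
          wd (Dv.comp (extZ incl)) =>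
        ((WSup.toPiL (fun c : ι => wt (incl c) ^ 3 *
            pinW δ' (pinDist B₀ hB₀ ∘ fun c : ι => proj T (incl c).1.1) c) 1).symm
          (fun c : ι => locGrad (etaScale η (fun A : ↥Λ → 𝔸 =>
              ∑ p ∈ Pl, ord₃ (plaqFunSym τ (fun b : ↥Λ => U₀ b.1.1 b.1.2) (bd p)) A))
            (WMax.toPiL (fun b => wt b * pinW δ' (pinDist B₀ hB₀ ∘ fun b : ↥Λ => proj T b.1.1) b) wd Dv
              ((WMax.toPiL (fun b => wt b * pinW δ' (pinDist B₀ hB₀ ∘ fun b : ↥Λ => proj T b.1.1) b) wd Dv).symm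
                (extZ incl (WMax.toPiL
                  (fun c : ι => wt (incl c) * pinW δ' (pinDist B₀ hB₀ ∘ fun c : ι => proj T (incl c).1.1) c)
                  wd (Dv.comp (extZ incl)) Yb))))
            (incl c)) :
          WSup (fun c : ι => wt (incl c) ^ 3 * pinW δ' (pinDist B₀ hB₀ ∘ fun c : ι => proj T (incl c).1.1) c) 1
            (𝔸 →L[ℂ] ℂ)))
      (((72 * ((d : ℝ) - 1) * ‖τ‖ * Lc ^ 3) * ((3 * d + 2) * d : ℕ)
          + 8 * (‖τ‖ * (248 / 3 * ε₀ + 40 / 3 * ε)) * Lc ^ 4 * (4 * (4 * d : ℕ))) * Real.exp (δ' * 2))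
      (ε / 2) := by
  have hd : 0 ≤ (d : ℝ) - 1 := by
    have : (1 : ℝ) ≤ d := by exact_mod_cast hd1
    linarith
  have hLc0 : 0 ≤ Lc := zero_le_one.trans hLc
  have hM0 : 0 ≤ ((72 * ((d : ℝ) - 1) * ‖τ‖ * Lc ^ 3) * ((3 * d + 2) * d : ℕ)
      + 8 * (‖τ‖ * (248 / 3 * ε₀ + 40 / 3 * ε)) * Lc ^ 4 * (4 * (4 * d : ℕ))) * Real.exp (δ' * 2) := by positivity
  exact Prop4Hyp.comp_extZ incl (fun b => wt b * pinW δ' (pinDist B₀ hB₀ ∘ fun b : ↥Λ => proj T b.1.1) b) wd Dv hincl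
    (prop4Hyp_pinned_ord₃_eta_levels_frozen_torusPin Λ Pl τ h₀ bd wt wd Dv Wf Wd W incl hη htr hincr hLc hst hbd hor
      hWd0 hWf hcf hcd hDv hε hε₀ hε4 hηW hWw hwW hreg hd1 B₀ hB₀ hδ') hM0

end Block

end Summit.QuantumFields.BalabanUV.T4Continuum.ShellMeasurePlaquetteCubicFrozenBlock

end
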